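import Summits.QuantumFields.BalabanUV.Beta.FP.TadpoleFree
import Summits.QuantumFields.BalabanUV.Beta.FP.SymmetryKHolds

/-!
# `BalabanUV.Beta.FP.TadpoleFreeVertex` — road «FP» for binder row D1, RULING R-FP-46 row **TAD-INST** (owner, gen 15): THE CHAIN-RULE VERTEX THROUGH A
# REFLECTION-INVARIANT PACKED RESOLVENT IS TADPOLE-FREE for block-translation and reflection covariant stencils — and, KERNEL SIDE UNCONDITIONAL,
# SO IS THE LITERAL's PERFECT ONE-STEP SYSTEM: `tadpole (KPerf 1) (vertexOfK (KPerf 1) Lc S μ y) = 0` (`d = 3`, `2 ≤ Lc`) given only the stencil's (St♭)(Sr) letters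

HONEST DEPENDENCY (page 1, mandatory): continuum YM on T⁴ ⇐ BetaPertH ∧ nine spine estimates (0/9 proved); BetaPertH ⇐ (D1) ∧ (D4) ∧ CAP+tail;
G-an2-4 gates asym, D1 and NE2/3/4.  HONEST FRAMING (cell contract, verbatim): «discharging `BetaPertH` makes Bałaban's UV stability UNCONDITIONAL —
a real constructive-QFT result; it is NOT the continuum limit and NOT the Clay problem.»  THIS MODULE composes BY NAME: the owner's
`TadpoleFree.oneLoopTadpole_eq_zero`, an5's `ResolventReflection.vertexOfK_reflect` ∕ `vertexOfK_translate_block` ∕ `Φ` ∕ `bref_eq_bondRefl`, an4's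
`OneStepKernelFamily.vertexFamily_vertexOfK'`, and the UNCONDITIONAL kernel side `SymmetryKHolds.kernelSide_KPerf_one_holds` (X1-K at `m = 1`, `convCKWall_holds`).
No `def`, no `def … : Prop`, nothing cited, 0 sorry; 0∕4 row-D1 binders; the stencil covariances (St♭)(Sr) stay HYPOTHESES (the literal's letters, the same class
that feeds the END's `hKcov` ∕ N3(ii)); NOT SDF, NOT D1, NOT BetaPertH, NOT continuum, NOT Clay.  «not in print; our bookkeeping».

ABSOLUTE RULE (cell charter, verbatim): «No internally-minted statement may enter as a cited fact. Every hypothesis is either kernel-proved in this package or a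
verbatim quotation of a PUBLISHED theorem with page reference. The manuscript(s) under audit are NOT citable for their own disputed steps — they are the thing
under adjudication; programme-internal (2001/route/tribunal) claims are never citable.»

WHY (RULING R-FP-46, owner gen 15).  Under nested dressing (R-FP-45 (B)) the one-loop functionals compose exactly (model oracle `FP/NestedDressingHessian` ✓ ∕
`FP/EffectiveFormJets` ✓), so the road's step defect is an2's cross term `D m = dF₁ ∘ d²U^c_m` (X-an2-54, `Beta.StepDefectTadpole`): it vanishes as a KERNEL iff
the one-point function `b₁ ↦ ½·tadpole (KPerf 1) (vertexOfK (KPerf 1) Lc S∞ b₁)` of the literal's perfect one-step system does (row TAD-FREE ∕ TAD-INST).  In the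
genuine theory this is `tr ad = 0`; for the colour-stripped typed objects it is LATTICE SYMMETRY: the perfect resolvent is reflection-invariant and block
covariant with 0 hypotheses (`kernelSide_KPerf_one_holds`), the chain-rule vertex inherits the stencil's covariances (`vertexOfK_reflect`,
`vertexOfK_translate_block`), and `TadpoleFree.oneLoopTadpole_eq_zero` concludes.

CONTENTS ([folklore] + [our object] instance):
* §1 **`tadpole_vertexOfK_eq_zero`** — K-generic (any `d`, `N`): decaying, block-covariant, reflection-invariant `K` + a local stencil family with (St♭)(Sr)
  ⟹ `tadpole K (vertexOfK K N S μ y) = 0` for all `μ`, `y`.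
* §2 **`tadpole_vertexOfK_KPerf_one_eq_zero`** — `d = 3`, `2 ≤ Lc`, adopted units, `K := KPerf Lc (sfStep Lc) (smStep 3 Lc) 1`, `N := Lc`: KERNEL SIDE UNCONDITIONAL;
  hypotheses = the stencil's locality + (St♭)(Sr) only.  Read at `S := SPerfOf … S 1` (the literal's perfect dressed stencil) this is TAD-INST of R-FP-46.
Provenance: road FP OWNER b2b-balaban-beta-d1-p3 gen 15 (prover-b2b-balaban-beta-d1-p3-g15-0), 2026-08-21.  Orientation only (nothing quoted is load-bearing): [Balaban1987RG1]
(5.7)–(5.8) p. 293 for the reflection laws as typed in `Beta.PolarizationSign`.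
-/

noncomputable section

namespace Summit.QuantumFields.BalabanUV.Beta.FP.TadpoleFreeVertex

open Literature.MathematicalPhysics.QuantumFieldTheory.Balaban1983to89
open Literature.MathematicalPhysics.QuantumFieldTheory.Balaban1983to89.Beta
open ExpKernelCalculus (MKer Decays BiLoc VertexFamily tadpole shiftK)
open PolarizationSign (reflSign)
open KernelReflection (refK)
open ResolventReflection (Φ bref bref_eq_bondRefl vertexOfK_reflect vertexOfK_translate_block)
open OneStepResolventKernel (Fib LocStencil decays_mono biLoc_mono)
open OneStepKernelFamily (vertexOfK vertexFamily_vertexOfK')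
open Summit.QuantumFields.BalabanUV.Beta.GAN24.CombesThomas (sfStep smStep)
open Summit.QuantumFields.BalabanUV.Beta.FP.PerfectObjectsT (KPerf)
open Summit.QuantumFields.BalabanUV.Beta.FP.SymmetryKHolds (kernelSide_KPerf_one_holds)
open Summit.QuantumFields.BalabanUV.Beta.FP.TadpoleFree (oneLoopTadpole_eq_zero)

/-! ## §1 K-generic: the chain-rule vertex through a symmetric packed resolvent is tadpole-free -/

section Generic

variable {d N : ℕ}

/-- [folklore] **THE CHAIN-RULE VERTEX IS TADPOLE-FREE.**  For ANY packed kernel `K` that decays, is block-translation covariant (`hKs`) and reflection-invariant for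
every axis (`hKr`), and ANY local stencil family `S` that is block-translation (St♭) and reflection (Sr) covariant:
`tadpole K (vertexOfK K N S μ y) = 0` for every coarse bond `(μ, y)` — the one-point function of the one-loop system `(K, vertexOfK K N S)` vanishes identically. -/
theorem tadpole_vertexOfK_eq_zero {K : MKer (d + 1) (Fib d)}
    (hKd : ∃ δ C : ℝ, 0 < δ ∧ 0 ≤ C ∧ Decays K C δ) (hKs : ∀ t : Fin (d + 1) → ℤ, shiftK (-((N : ℤ) • t)) K = K)
    (hKr : ∀ α : Fin (d + 1), refK (Φ N α) K = K)
    {S : Fin (d + 1) → (Fin (d + 1) → ℤ) → MKer (d + 1) (Fib d)} {Cs δs : ℝ} (hS : LocStencil S Cs δs) (hδs : 0 < δs)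
    (hSt : ∀ (κ' : Fin (d + 1)) (u t : Fin (d + 1) → ℤ), S κ' (u + (N : ℤ) • t) = shiftK (-((N : ℤ) • t)) (S κ' u))
    (hSr : ∀ (α κ' : Fin (d + 1)) (u : Fin (d + 1) → ℤ), S κ' (bref α κ' u) = reflSign α κ' • refK (Φ N α) (S κ' u))
    (μ : Fin (d + 1)) (y : Fin (d + 1) → ℤ) : tadpole K (vertexOfK K N S μ y) = 0 := by
  obtain ⟨Cv, δv, hδv, hV⟩ := vertexFamily_vertexOfK' (N := N) hKd hS hδs
  obtain ⟨δK, C, hδK, hC, hK⟩ := hKd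
  have hCv : 0 ≤ Cv := (hV 0 0).nonneg (Sum.inl 0)
  have hδ₀ : 0 < min δK δv := lt_min hδK hδv
  have hK' : Decays K C (min δK δv) := decays_mono hK hC le_rfl (min_le_left _ _)
  have hV' : VertexFamily (vertexOfK K N S) N Cv (min δK δv) := fun μ' y' => biLoc_mono (hV μ' y') hCv (min_le_right _ _)
  exact oneLoopTadpole_eq_zero hK' hV' hδ₀ hKs (vertexOfK_translate_block hKs hSt)
    (fun α => ⟨Φ N α, hKr α, 1, fun μ' y' => by rw [← bref_eq_bondRefl]; exact vertexOfK_reflect (hKr α) (hSr α) μ' y'⟩) μ y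

end Generic

/-! ## §2 The literal's perfect one-step system (kernel side unconditional) -/

section Perfect

variable {Lc : ℕ} [NeZero Lc]

/-- [our object] **TAD-INST, KERNEL SIDE UNCONDITIONAL** (`d = 3`, `2 ≤ Lc`, adopted units; RULING R-FP-46): for ANY local stencil family `S` on blocking `Lc` that is
block-translation (St♭) and reflection (Sr) covariant, the perfect one-step system is tadpole-free:
`tadpole (KPerf Lc (sfStep Lc) (smStep 3 Lc) 1) (vertexOfK (KPerf … 1) Lc S μ y) = 0` for all `μ`, `y`
(`SymmetryKHolds.kernelSide_KPerf_one_holds` ⊕ §1).  Read at `S := SPerfOf (sfStep Lc) (smStep 3 Lc) S 1` — the literal's perfect dressed stencil, whose (St♭)(Sr)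
are the limits of the finite-`j` letters (`SymmetryK.translate_limStOf` ∕ `reflect_limStOf`) — this kills the nested step defect `D m = dF₁ ∘ d²U^c_m`. -/
theorem tadpole_vertexOfK_KPerf_one_eq_zero (hLc : 2 ≤ Lc)
    {S : Fin (3 + 1) → (Fin (3 + 1) → ℤ) → MKer (3 + 1) (Fib 3)} {Cs δs : ℝ} (hS : LocStencil S Cs δs) (hδs : 0 < δs)
    (hSt : ∀ (κ' : Fin (3 + 1)) (u t : Fin (3 + 1) → ℤ), S κ' (u + (Lc : ℤ) • t) = shiftK (-((Lc : ℤ) • t)) (S κ' u))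
    (hSr : ∀ (α κ' : Fin (3 + 1)) (u : Fin (3 + 1) → ℤ), S κ' (bref α κ' u) = reflSign α κ' • refK (Φ (d := 3) Lc α) (S κ' u))
    (μ : Fin (3 + 1)) (y : Fin (3 + 1) → ℤ) :
    tadpole (KPerf (d := 3) Lc (sfStep Lc) (smStep 3 Lc) 1) (vertexOfK (KPerf (d := 3) Lc (sfStep Lc) (smStep 3 Lc) 1) Lc S μ y) = 0 := by
  obtain ⟨hKd, hKs, hKr⟩ := kernelSide_KPerf_one_holds hLc
  exact tadpole_vertexOfK_eq_zero hKd hKs hKr hS hδs hSt hSr μ y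

end Perfect

end Summit.QuantumFields.BalabanUV.Beta.FP.TadpoleFreeVertex

end
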